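import Summits.Ventures.PercRepro.MSTightConjTAlpha

/-!
# Conjecture (T), the general form, as a candidate Prop

Dossier proofs/MINE1-theoremS.md, Addendum 45. `ConjT α` (never asserted): for a family `F` of
Marica–Schönheim excess one with `∅, univ ∉ F`, full support and empty core, every element `r`
with a tight trace has `diffsY r F ⊆ diffsX r F` (every type-I difference `t ∖ s`, `t ∪ r ∈ F`,
`s ∈ F`, is an `r`-free difference) — equivalently `diffsX r F = D(proj r F)`, `|Y| = |K| + 1`,
`F ∖∖ F` closed under removing `r`. Census (own enumerator): 0 violations over all excess-one
families on `[4]` and `[5]` and on `[6]` with `|F| ≤ 14`, twins allowed; the hypotheses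
`∅, univ ∉ F` and full support / empty core are the exact ones (`{∅, 0, 1, 02, 12, 012}` at
`r = 2` and `{0, 01, 02, 013, 023, 0123}` at `r = 3` fail without them). Case (α) of the excess
split is the theorem `diffsY_subset_diffsX_of_tight_partner` (MSTightConjTAlpha); the reductions
(TB) ⟹ (T) and dichotomy ⟹ (T) are in MSTightConjTReductions.
-/

namespace PercRepro.MSTight

open Finset
open scoped FinsetFamily

variable {α : Type*} [DecidableEq α] [Fintype α] {r : α} {F : Finset (Finset α)}

section Candidate

variable (α)

/-- **Conjecture (T), the general form, as a candidate Prop** (never asserted): for a family `F` of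
Marica–Schönheim excess one with `∅, univ ∉ F`, full support and empty core, every element `r`
with a tight trace has `diffsY r F ⊆ diffsX r F` — equivalently `diffsX r F = D(proj r F)`,
`|Y| = |K| + 1`, and `F ∖∖ F` closed under removing `r`. Census (Addendum 45): 0 violations on all
excess-one families on `[4]`, `[5]` and on `[6]` with `|F| ≤ 14` (twins allowed; the hypotheses
`∅, univ ∉ F` and full support / empty core are the exact ones — `{∅, 0, 1, 02, 12, 012}` at `r = 2`
and `{0, 01, 02, 013, 023, 0123}` at `r = 3` fail without them). Case (α) of the excess split is the
theorem `diffsY_subset_diffsX_of_tight_partner` (MSTightConjTAlpha). -/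
def ConjT : Prop :=
  ∀ (F : Finset (Finset α)) (r : α), (F \\ F).card = F.card + 1 →
    (∅ : Finset α) ∉ F → (univ : Finset α) ∉ F → (∀ a, ∃ t ∈ F, a ∉ t) → (∀ a, ∃ t ∈ F, a ∈ t) →
    Tight (proj r F) → diffsY r F ⊆ diffsX r F

variable {α}

/-- Under `ConjT α`, `X = D(P)` at every tight trace. -/
theorem diffsX_eq_diffs_proj_of_conjT (hC : ConjT α) (hF : (F \\ F).card = F.card + 1)
    (hE : (∅ : Finset α) ∉ F) (hU : (univ : Finset α) ∉ F) (hcore : ∀ a, ∃ t ∈ F, a ∉ t)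
    (hsupp : ∀ a, ∃ t ∈ F, a ∈ t) (hP : Tight (proj r F)) :
    diffsX r F = proj r F \\ proj r F := by
  rw [diffs_proj_eq]
  exact (union_eq_left.2 (hC F r hF hE hU hcore hsupp hP)).symm

/-- Under `ConjT α`, `|Y| = |K| + 1` at every tight trace. -/
theorem card_diffsY_of_conjT (hC : ConjT α) (hF : (F \\ F).card = F.card + 1)
    (hE : (∅ : Finset α) ∉ F) (hU : (univ : Finset α) ∉ F) (hcore : ∀ a, ∃ t ∈ F, a ∉ t)
    (hsupp : ∀ a, ∃ t ∈ F, a ∈ t) (hP : Tight (proj r F)) :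
    (diffsY r F).card = (partner r F).card + 1 := by
  have h := hC F r hF hE hU hcore hsupp hP
  have hY : diffsX r F ∩ diffsY r F = diffsY r F := inter_eq_right.2 h
  rw [← hY]
  exact (tight_proj_iff_card_edges hF r).1 hP

end Candidate

end PercRepro.MSTight
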